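import Summits.QuantumAdvantage.QuantumAdvantage.Theorems.CubicForrelationNearExactIsExactKtGapTwoStep
import Summits.QuantumAdvantage.QuantumAdvantage.Theorems.CubicForrelationNearExactIsExactTwelveTypeO896

/-!
# Crux `CubicForrelation.NearExactIsExact` (stmt-QuantumAdvantage-14043) — the SECOND Kasami–Tokura gap of cubics: no Boolean function of
  degree `≤ 3` on `m ≤ 12` bits has weight strictly between `7·2^{m-5}` and `7.5·2^{m-5}`; in particular NO CUBIC ON 12 BITS HAS WEIGHT IN
  `(896, 960)`, so a TYPE-O side of a cubic pair on 12 bits has `Φ ≤ 932/1024`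

Certificate seat `b2b-cforr-cert` (gen 18).  HONEST FRAMING: a coding-theory BRICK (standard axioms, no `decide`) — the classification-free
substitute for the part of Kasami–Tokura's theorem (1970: the weights of `RM(r,m)` below `2d` are `2d(1 − 2^{−μ})`, `2d(1 − 2^{−μ} − 2^{−ν})`-type
values; for `RM(3,12)` below `1024`: `0, 512, 768, 896, 960, 992`) that the TYPE-O branch of the `n = 12` window analysis needs on
`(932/1024, 936/1024]`: there a type-O side has a cubic base set `E` with `896 < #E < 960` (`to18_typeO_gt932_weight`, gen 18).  Gens 16–18
closed `936, 935, 934` on the type-O side configuration by configuration (`#E = 896` at zero excess, `904` by a mod-16 character argument, `912`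
by self-dual rigidity and two periods, `928` by the partner parity); this file closes ALL of `(932/1024, 936/1024]` at once and uniformly:
`to18_typeO_le_932`.  NOT summit progress; no new value of `θ₁₂` by itself (the level-`≥ 6` branch at `Σ e² = 728` is the other half of
the rung `933/1024`).

Method (induction on `m`, `…KtGapTwoTools`, `…KtGapTwoClosure`, `…KtGapTwoStep`): for a cubic on `k + 5` bits with `7L < w < 7.5L` (`L = 2^k`, `t = w − 7L`) and
the gap on `k + 4` bits, the derivative intersections take the values `t, L+t, 3L+t` (no period), the character sums `F(z)`, `z ≠ 0`, the
values `±t, ±(L+t), ±(3L+t)` (half weights are cubic weights on `k + 4` bits: `rm3_weights_below_seven_quarters` + the hypothesis; no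
hyperplane contains the support); Parseval, `Σ I = w²` and the fourth moment give a linear Diophantine system in the six multiplicities, and
`Σ I = w²` gives `L ∣ t²`.  NEW: the directions with `|F| = 3L + t` are those where one side of the hyperplane carries a minimum-weight word of
`RM(4,m)` (a flat); with `0` they form a `⊕`-closed set, so their number `C` satisfies `C + 1 = 2^j`.  `ktg2_no_solution`: for `k ≤ 7` the
system has no solution — `L ∣ t²` and `2t < L` leave `t ∈ {4}, {8}, {8,16,24}, {16,32,48}` for `k = 4, 5, 6, 7`; all die by integrality
(`omega`) except `(k,t) = (5,8)` (`w = 232` on 10 bits) and `(6,8)` (`w = 456` on 11 bits), where the system forces `C = 9` and `C + 1 = 10`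
is not a power of two.  (Numerically the same closing works for every `k ≤ 15`, HOME/b2b-cforr-cert-g18/kt2/dioph2.py.)

Main statements: `kt_gap2_cubic_le_twelve`, `kt_gap2_twelve` (no cubic on 12 bits has weight in `(896, 960)`), `rm3_weights_below_fifteen_eighths`
(`m ≤ 12`: a cubic with `w < 1.875d` has `w ∈ {0, d, 1.5d, 1.75d}`), `to18_typeO_le_932` / `to18_typeO_gt932_false` (a type-O side on 12 bits
has `Φ ≤ 932/1024`).

References: T. Kasami, N. Tokura, *On the weight structure of Reed–Muller codes*, IEEE Trans. IT 16 (1970) 752–759 (Thm 1); F. J.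
MacWilliams, N. J. A. Sloane (1977) Ch. 13 §4, Ch. 15 §3; R. O'Donnell (2014) §3.3.  Everything below is proved from Mathlib and the tree;
axioms are the standard three.
-/

set_option linter.dupNamespace false -- D-0017: single-problem summit ⇒ `QuantumAdvantage.QuantumAdvantage` by design

noncomputable section

namespace Summit.QuantumAdvantage.QuantumAdvantage.Theorems.CubicForrelation.NearExactIsExact

open Finset
open Literature.Computability.QuantumComplexity
open Literature.Computability.QuantumComplexity.BuzetChailloux (bxor zeroVec bxor_bxor_cancel_left bxor_zeroVec zeroVec_bxor bxor_comm
  bxor_self twist_zeroVec_right twist_bxor_right)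
open Literature.Computability.QuantumComplexity.DerivativeWalsh (W twist_bxor_left)
open Literature.Computability.QuantumComplexity.Simon (twist_eq_one_or)
open Summit.QuantumAdvantage.QuantumAdvantage.Theorems.NearExactIsExact.Negative (TypeOTwelve.typeO_of_exists_odd)

/-! ### The Diophantine system with the closure constraint has no solution for `k ≤ 7` (`m ≤ 12`) -/

/-- `k = 5` (`m = 10`): `32 ∣ t²` and `2t < 32` force `t = 8` (`w = 232`); Parseval + count give `B + 7C = 77`, `Σ I` gives `3n₁ + n₂ = 1419`,
the fourth moment `32 n₁ = 2783 + 13B + 595C`; the only solution in naturals has `C = 9`, and `C + 1 = 10` is not a power of two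
(here: `≠` the value `P` of `2^j`). [this work] -/
theorem ktg2_no_solution_five (w t A B C n₁ n₂ n₃ P : ℕ) (hw : w = 7 * 2 ^ 5 + t) (ht : 0 < t)
    (h2 : 2 * t < 2 ^ 5) (hdvd : 2 ^ 5 ∣ t * t) (hABC : A + B + C + 1 = 32 * 2 ^ 5)
    (hP : A * t ^ 2 + B * (2 ^ 5 + t) ^ 2 + C * (3 * 2 ^ 5 + t) ^ 2 + w ^ 2 = 32 * 2 ^ 5 * w)
    (hn : n₁ + n₂ + n₃ + 1 = 32 * 2 ^ 5) (hI : n₁ * (3 * 2 ^ 5 + t) + n₂ * (2 ^ 5 + t) + n₃ * t + w = w ^ 2)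
    (h4 : w ^ 4 + A * t ^ 4 + B * (2 ^ 5 + t) ^ 4 + C * (3 * 2 ^ 5 + t) ^ 4 =
      32 * 2 ^ 5 * (w ^ 2 + n₁ * (3 * 2 ^ 5 + t) ^ 2 + n₂ * (2 ^ 5 + t) ^ 2 + n₃ * t ^ 2))
    (hC : C + 1 = P) (hj10 : P ≠ 10) : False := by
  have h8t : 2 ^ 3 ∣ t := by have := ktg_two_pow_dvd_of_sq (a := 5) (by simpa using hdvd); simpa using this
  obtain ⟨q, rfl⟩ : ∃ q, t = 8 * q := ⟨t / 8, by omega⟩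
  have hq : q < 2 := by omega
  interval_cases q
  · omega
  · subst hw; norm_num at hP hI h4 hABC hn
    have e1 : B + 7 * C = 77 := by clear h4 hI hn; omega
    have e2 : 3 * n₁ + n₂ = 1419 := by clear h4 hP hABC; omega
    have key : 32 * n₁ = 2783 + 13 * B + 595 * C := by linarith
    clear h4 hP hI
    omega

/-- `k = 6` (`m = 11`): `64 ∣ t²` and `2t < 64` leave `t ∈ {8, 16, 24}` (`w ∈ {456, 464, 472}`); `t = 16, 24` die by Parseval + count
(`3B + 21C = 103`, `7B + 45C + 425 = 0`), and at `t = 8` the system (`5B + 39C = 581`, `3n₁ + n₂ = 2986`, `384 n₁ = 85763 + 205B + 12207C`)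
forces `C = 9`, `C + 1 = 10`. [this work] -/
theorem ktg2_no_solution_six (w t A B C n₁ n₂ n₃ P : ℕ) (hw : w = 7 * 2 ^ 6 + t) (ht : 0 < t)
    (h2 : 2 * t < 2 ^ 6) (hdvd : 2 ^ 6 ∣ t * t) (hABC : A + B + C + 1 = 32 * 2 ^ 6)
    (hP : A * t ^ 2 + B * (2 ^ 6 + t) ^ 2 + C * (3 * 2 ^ 6 + t) ^ 2 + w ^ 2 = 32 * 2 ^ 6 * w)
    (hn : n₁ + n₂ + n₃ + 1 = 32 * 2 ^ 6) (hI : n₁ * (3 * 2 ^ 6 + t) + n₂ * (2 ^ 6 + t) + n₃ * t + w = w ^ 2)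
    (h4 : w ^ 4 + A * t ^ 4 + B * (2 ^ 6 + t) ^ 4 + C * (3 * 2 ^ 6 + t) ^ 4 =
      32 * 2 ^ 6 * (w ^ 2 + n₁ * (3 * 2 ^ 6 + t) ^ 2 + n₂ * (2 ^ 6 + t) ^ 2 + n₃ * t ^ 2))
    (hC : C + 1 = P) (hj10 : P ≠ 10) : False := by
  have h8t : 2 ^ 3 ∣ t := by have := ktg_two_pow_dvd_of_sq (a := 6) (by simpa using hdvd); simpa using this
  obtain ⟨q, rfl⟩ : ∃ q, t = 8 * q := ⟨t / 8, by omega⟩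
  have hq : q < 4 := by omega
  interval_cases q
  · omega
  · subst hw; norm_num at hP hI h4 hABC hn
    have e1 : 5 * B + 39 * C = 581 := by clear h4 hI hn; omega
    have e2 : 3 * n₁ + n₂ = 2986 := by clear h4 hP hABC; omega
    have key : 384 * n₁ = 85763 + 205 * B + 12207 * C := by linarith
    clear h4 hP hI
    omega
  · subst hw; norm_num at hP hABC; clear h4 hI hn; omega
  · subst hw; norm_num at hP hABC; clear h4 hI hn; omega

/-- `k = 7` (`m = 12`): `128 ∣ t²` and `2t < 128` leave `t ∈ {16, 32, 48}` (`w ∈ {912, 928, 944}`); `t = 32, 48` die by Parseval + count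
(`B + 7C + 51 = 0`, `7B + 45C + 1577 = 0`), and at `t = 16` Parseval + count give `5B + 39C = 453` (so `C ∈ {2, 7}`) while the fourth
moment `192 n₁ = 87171 + 205B + 12207C` then has no integral `n₁`. [this work] -/
theorem ktg2_no_solution_seven (w t A B C n₁ n₂ n₃ P : ℕ) (hw : w = 7 * 2 ^ 7 + t) (ht : 0 < t)
    (h2 : 2 * t < 2 ^ 7) (hdvd : 2 ^ 7 ∣ t * t) (hABC : A + B + C + 1 = 32 * 2 ^ 7)
    (hP : A * t ^ 2 + B * (2 ^ 7 + t) ^ 2 + C * (3 * 2 ^ 7 + t) ^ 2 + w ^ 2 = 32 * 2 ^ 7 * w)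
    (hn : n₁ + n₂ + n₃ + 1 = 32 * 2 ^ 7) (hI : n₁ * (3 * 2 ^ 7 + t) + n₂ * (2 ^ 7 + t) + n₃ * t + w = w ^ 2)
    (h4 : w ^ 4 + A * t ^ 4 + B * (2 ^ 7 + t) ^ 4 + C * (3 * 2 ^ 7 + t) ^ 4 =
      32 * 2 ^ 7 * (w ^ 2 + n₁ * (3 * 2 ^ 7 + t) ^ 2 + n₂ * (2 ^ 7 + t) ^ 2 + n₃ * t ^ 2))
    (hC : C + 1 = P) : False := by
  have h16t : 2 ^ 4 ∣ t := by have := ktg_two_pow_dvd_of_sq (a := 7) (by simpa using hdvd); simpa using this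
  obtain ⟨q, rfl⟩ : ∃ q, t = 16 * q := ⟨t / 16, by omega⟩
  have hq : q < 4 := by omega
  interval_cases q
  · omega
  · subst hw; norm_num at hP hI h4 hABC hn
    have e1 : 5 * B + 39 * C = 453 := by clear h4 hI hn; omega
    have e2 : 3 * n₁ + n₂ = 5979 := by clear h4 hP hABC; omega
    have key : 192 * n₁ = 87171 + 205 * B + 12207 * C := by linarith
    clear h4 hP hI
    omega
  · subst hw; norm_num at hP hABC; clear h4 hI hn; omega
  · subst hw; norm_num at hP hABC; clear h4 hI hn; omega

/-- **No solution for `k ≤ 7`.**  See the module docstring: `2^k ∣ t²` and `2t < 2^k` leave at most three values of `t`; the linear system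
then has no solution in natural numbers, except at `(k,t) = (5,8), (6,8)` where it forces `C = 9`, and `C + 1 = 10 ≠ 2^j`. [this work] -/
theorem ktg2_no_solution (k : ℕ) (hk : k ≤ 7) (w t A B C n₁ n₂ n₃ j : ℕ) (hw : w = 7 * 2 ^ k + t) (ht : 0 < t)
    (h2 : 2 * t < 2 ^ k) (hdvd : 2 ^ k ∣ t * t) (hABC : A + B + C + 1 = 32 * 2 ^ k)
    (hP : A * t ^ 2 + B * (2 ^ k + t) ^ 2 + C * (3 * 2 ^ k + t) ^ 2 + w ^ 2 = 32 * 2 ^ k * w)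
    (hn : n₁ + n₂ + n₃ + 1 = 32 * 2 ^ k) (hI : n₁ * (3 * 2 ^ k + t) + n₂ * (2 ^ k + t) + n₃ * t + w = w ^ 2)
    (h4 : w ^ 4 + A * t ^ 4 + B * (2 ^ k + t) ^ 4 + C * (3 * 2 ^ k + t) ^ 4 =
      32 * 2 ^ k * (w ^ 2 + n₁ * (3 * 2 ^ k + t) ^ 2 + n₂ * (2 ^ k + t) ^ 2 + n₃ * t ^ 2))
    (hC : C + 1 = 2 ^ j) : False := by
  have hj10 : 2 ^ j ≠ 10 := by
    intro h2j
    rcases Nat.lt_or_ge j 4 with hj | hj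
    · interval_cases j <;> norm_num at h2j
    · have := Nat.pow_le_pow_right (show 0 < 2 by norm_num) hj
      norm_num at this; omega
  -- hide `2 ^ j` from `omega` behind a plain variable
  obtain ⟨P, hPj⟩ : ∃ P, 2 ^ j = P := ⟨_, rfl⟩
  rw [hPj] at hC hj10
  clear hPj
  interval_cases k
  · -- k = 0: `2t < 1`
    omega
  · -- k = 1: `2t < 2`
    omega
  · -- k = 2: `t = 1`, but `4 ∣ t²` gives `2 ∣ t`
    have h2t : 2 ^ 1 ∣ t := by have := ktg_two_pow_dvd_of_sq (a := 2) (by simpa using hdvd); simpa using this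
    omega
  · -- k = 3: `8 ∣ t²` ⇒ `4 ∣ t`, `t < 4`
    have h4t : 2 ^ 2 ∣ t := by have := ktg_two_pow_dvd_of_sq (a := 3) (by simpa using hdvd); simpa using this
    omega
  · -- k = 4 (m = 9): `16 ∣ t²` ⇒ `4 ∣ t`, `t < 8`: `t = 4`, `w = 116`; Parseval + count: `3B + 21C = 295`, not divisible by 3
    have h4t : 2 ^ 2 ∣ t := by have := ktg_two_pow_dvd_of_sq (a := 4) (by simpa using hdvd); simpa using this
    obtain ⟨q, rfl⟩ : ∃ q, t = 4 * q := ⟨t / 4, by omega⟩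
    have hq : q < 2 := by omega
    interval_cases q
    · omega
    · subst hw; norm_num at hP hABC; clear h4 hI hn; omega
  · exact ktg2_no_solution_five w t A B C n₁ n₂ n₃ P hw ht h2 hdvd hABC hP hn hI h4 hC hj10
  · exact ktg2_no_solution_six w t A B C n₁ n₂ n₃ P hw ht h2 hdvd hABC hP hn hI h4 hC hj10
  · exact ktg2_no_solution_seven w t A B C n₁ n₂ n₃ P hw ht h2 hdvd hABC hP hn hI h4 hC

/-! ### The second gap, by induction on `m ≤ 12` -/

/-- **The second Kasami–Tokura gap of cubics for `m ≤ 12`.**  No Boolean function of degree `≤ 3` on `m ≤ 12` bits has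
`7·2^m < 32·#{c = 1}` and `64·#{c = 1} < 15·2^m`, i.e. weight strictly between `1.75 d` and `1.875 d`, `d = 2^{m-3}`.  (Kasami–Tokura 1970
prove this for every `m` via their classification of the words of weight `< 2d`; the induction below is classification-free and uniform
except for the closing arithmetic `ktg2_no_solution`, done here up to `m = 12`.)  NOT summit progress. [this work; cite: KasamiTokura1970
Thm 1, MacWilliamsSloane1977 Ch. 15 §3] -/
theorem kt_gap2_cubic_le_twelve : ∀ m ≤ 12, ∀ c : (Fin m → Bool) → Bool, IsDegLeFun 3 c →
    ¬ (7 * 2 ^ m < 32 * #(univ.filter fun x => c x = true) ∧ 64 * #(univ.filter fun x => c x = true) < 15 * 2 ^ m) := by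
  intro m
  induction m with
  | zero => intro _ c _ h; simp only [pow_zero] at h; omega
  | succ m ihm =>
    intro hm c hc h
    rcases Nat.lt_or_ge m 4 with hm4 | hm4
    · -- `m + 1 ≤ 4`: the interval is empty
      obtain ⟨h1, h2⟩ := h
      interval_cases m <;> norm_num at h1 h2 <;> omega
    · obtain ⟨k, rfl⟩ : ∃ k, m = k + 4 := ⟨m - 4, by omega⟩
      have hk : k ≤ 7 := by omega
      have hN : 2 ^ (k + 4 + 1) = 32 * 2 ^ k := by ring
      rw [hN] at h
      have ih' : ∀ c' : (Fin (k + 4) → Bool) → Bool, IsDegLeFun 3 c' →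
          ¬ (7 * 2 ^ k < 2 * #(univ.filter fun y => c' y = true) ∧ 4 * #(univ.filter fun y => c' y = true) < 15 * 2 ^ k) := by
        intro c' hc' h'
        have hN4 : 2 ^ (k + 4) = 16 * 2 ^ k := by ring
        refine ihm (by omega) c' hc' ?_
        rw [hN4]; omega
      obtain ⟨w, t, A, B, C, n₁, n₂, n₃, j, hwS, hwt, hdvd, hABC, hP, hn, hI, h4, hC⟩ :=
        ktg2_step k ih' c hc (by omega) (by omega)
      exact ktg2_no_solution k hk w t A B C n₁ n₂ n₃ j hwt (by omega) (by omega) hdvd hABC hP hn hI h4 hC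

/-- **No cubic Boolean function on 12 bits has weight in `(896, 960)`** (the values `904, …, 952`; Kasami–Tokura: the weights of `RM(3,12)`
below `1024` are `0, 512, 768, 896, 960, 992`; the tree had the gap `(768, 896)`, `kt_gap_twelve`).  Finite-slice statement; NOT summit
progress. [this work] -/
theorem kt_gap2_twelve (c : (Fin (6 + 6) → Bool) → Bool) (hc : IsDegLeFun 3 c)
    (h1 : 896 < #(univ.filter fun x => c x = true)) (h2 : #(univ.filter fun x => c x = true) < 960) : False :=
  kt_gap2_cubic_le_twelve (6 + 6) (by norm_num) c hc ⟨by norm_num; omega, by norm_num; omega⟩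

/-- **Cubic weights below `1.875 d` on `m ≤ 12` bits**: a Boolean function of degree `≤ 3` on `m ≤ 12` bits with `64·#{c = 1} < 15·2^m` has
`#{c = 1} ∈ {0, 2^{m-3}, 1.5·2^{m-3}, 1.75·2^{m-3}}` (minimum weight, second weight, the two Kasami–Tokura gaps).  NOT summit progress.
[this work; cite: KasamiTokura1970 Thm 1] -/
theorem rm3_weights_below_fifteen_eighths {m : ℕ} (hm : m ≤ 12) (c : (Fin m → Bool) → Bool) (hc : IsDegLeFun 3 c)
    (h : 64 * #(univ.filter fun x => c x = true) < 15 * 2 ^ m) :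
    #(univ.filter fun x => c x = true) = 0 ∨ 8 * #(univ.filter fun x => c x = true) = 2 ^ m ∨
      16 * #(univ.filter fun x => c x = true) = 3 * 2 ^ m ∨ 32 * #(univ.filter fun x => c x = true) = 7 * 2 ^ m := by
  by_cases hlt : 32 * #(univ.filter fun x => c x = true) < 7 * 2 ^ m
  · rcases rm3_weights_below_seven_quarters c hc hlt with h0 | h0 | h0
    · exact Or.inl h0
    · exact Or.inr (Or.inl h0)
    · exact Or.inr (Or.inr (Or.inl h0))
  · have hg := kt_gap2_cubic_le_twelve m hm c hc
    right; right; right; omega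

/-! ### The type-O ceiling `932/1024` at `n = 12` -/

/-- **A type-O side has `Φ ≤ 932/1024` (12 bits).**  Cubic `f, g : 𝔽₂¹² → 𝔽₂` with `W_g = 16u` and some `u(x)` odd: `Φ(f,g) ≤ 932/1024`.
Above `932/1024` the base set `E = {d₁ = d₂}` — the support of a cubic — has `896 < #E < 960` (`to18_typeO_gt932_weight`: the budget
`4096 + 8#E ≤ 2¹⁷(1 − Φ)` gives `#E < 960`, and `#E ≤ 896` is excluded by `to15_typeO_E_ge_768`, `kt_gap_twelve`, `to18_typeO_E896_false`),
inside the second Kasami–Tokura gap `kt_gap2_twelve`.  The tree had the type-O branch closed down to `934/1024` (`to18_typeO_ge934_false`);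
this closes it on all of `(932/1024, 936/1024]` at once.  The level-`≥ 6` branch at `933/1024` is NOT treated here, so no new value of `θ₁₂`
follows from this file alone.  Finite-slice statement; NOT summit progress. [this work] -/
theorem to18_typeO_le_932 (f g : (Fin (6 + 6) → Bool) → Bool) (hf : IsDegLeFun 3 f) (hg : IsDegLeFun 3 g)
    (u : (Fin (6 + 6) → Bool) → ℤ) (hu : ∀ x, W (fun y => signOf (g y)) x = (2 : ℝ) ^ 4 * (u x : ℝ))
    (hodd : ∃ x, Odd (u x)) : forrelation f g ≤ 932 / 1024 := by
  classical
  by_contra hΦ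
  push Not at hΦ
  have hall : ∀ x, Odd (u x) := TypeOTwelve.typeO_of_exists_odd g u hg hu hodd
  have hu' : ∀ x, W (fun y => signOf (g y)) x = (2 : ℝ) ^ (2 * 2) * (u x : ℝ) := fun x => (hu x).trans (by norm_num)
  have hd1 : IsDegLeFun 1 (fun x => decide (Odd (u x / 2))) := z2_digitOne 2 g u hg hu' hall
  have hd2 : IsDegLeFun 3 (fun x => decide (Odd (u x / 2 / 2))) := z2_digitTwo 2 g u hg hu' hall
  have hdegE : IsDegLeFun (2 + 1) (fun x => (decide (Odd (u x / 2)) ^^ decide (Odd (u x / 2 / 2))) ^^ true) :=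
    tb_isDegLeFun_xor_const (bb_isDegLeFun_bxor (hd1.mono (by norm_num)) hd2) true
  have hsetE : (univ.filter fun x : Fin (6 + 6) → Bool =>
      ((decide (Odd (u x / 2)) ^^ decide (Odd (u x / 2 / 2))) ^^ true) = true) =
      univ.filter (fun x : Fin (6 + 6) → Bool => (Odd (u x / 2) ↔ Odd (u x / 2 / 2))) := by
    apply filter_congr
    intro x _
    by_cases h1 : Odd (u x / 2) <;> by_cases h2 : Odd (u x / 2 / 2) <;> simp [h1, h2]
  obtain ⟨hlo, hhi⟩ := to18_typeO_gt932_weight f g hf hg u hu hodd hΦ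
  exact kt_gap2_twelve _ hdegE (by rw [hsetE]; exact hlo) (by rw [hsetE]; exact hhi)

/-- **No type-O side above `932/1024` (12 bits)**, in the shape used by the window assemblies: cubic `f, g` with `W_g = 16u`, some `u(x)` odd
and `Φ(f,g) > 932/1024` cannot exist.  NOT summit progress. [this work] -/
theorem to18_typeO_gt932_false (f g : (Fin (6 + 6) → Bool) → Bool) (hf : IsDegLeFun 3 f) (hg : IsDegLeFun 3 g)
    (u : (Fin (6 + 6) → Bool) → ℤ) (hu : ∀ x, W (fun y => signOf (g y)) x = (2 : ℝ) ^ 4 * (u x : ℝ))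
    (hodd : ∃ x, Odd (u x)) (hΦ : (932 / 1024 : ℝ) < forrelation f g) : False := by
  have h := to18_typeO_le_932 f g hf hg u hu hodd
  linarith

end Summit.QuantumAdvantage.QuantumAdvantage.Theorems.CubicForrelation.NearExactIsExact

end
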